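import Literature.Probability.LatticeModels.WeightedCurrents
import HarnessLib

/-!
# Random currents with edge-dependent couplings: summability and the switching lemma

Topic `Literature/Probability/LatticeModels`. Sibling proof file of `WeightedCurrents.lean` (definitions
`Current.wweight`, `Current.eweight`, `wcurrentSum`, `ecurrentSum`, `ecurrentSumIn`; the uniform-`β`, `ℝ≥0∞`
sums `currentZ`/`cweight` of `ModifiedSimonInequality.lean` live on another current type, `edgesIn G Λ → ℕ`,
and are not used). Everything here is the edge-weighted (`K : E(G) → ℝ`, `K ≥ 0`) version of statements the
tree proves for a uniform `β` (`RandomCurrentsProofs.lean`, `CurrentSwitching.lean`), with the same proofs;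
the weight-free combinatorics (`Current.binom`, `Current.below`, `Current.switchCount(_symmDiff)`,
`Current.sum_below_binom_mul_eq`, `sum_spinProduct_mul_prod_bondSpin_pow`) is imported, not re-proved:

* `Current.wweight_mul_wweight_tsub` — `w_K(n) w_K(m-n) = w_K(m) binom(m,n)`;
* `Current.summable_wweight` — `∑_n w_K(n) ≤ ∏_e e^{K_e}` (`K ≥ 0`), finiteness of all `Z_K[A]`;
* `Current.tsum_prod_eweight_mul_eq` — resummation over the total current, in `ℝ≥0∞`;
* `Current.etsum_switching` — **the switching lemma** (Panis 2023, Lemma 4.4; Griffiths–Hurst–Sherman 1970;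
  Aizenman 1982) in the nested form of the tree's `Current.tsum_switching` (first current supported on a
  subgraph `G₁`, sources of the second prescribed inside a volume `Λ`, connection through `E(G₁)`), for
  `ℝ≥0∞`-valued `F` (no boundedness needed).

The Ising dictionary `∑_σ σ_A ∏_e e^{K_e σ_e} = 2^{|V|} Z_K[A]` is in `WeightedCurrentsDictionary.lean`.

## References

* R. Panis, arXiv:2309.05797 (2023), §4.1, Definition 4.1 and Lemma 4.4 [Panis2023Triviality] (held; read
  pp. 19–20).
* H. Duminil-Copin, arXiv:1607.06933 (2016), §2.1 eq. (2.2), Lemma 2.2 [DuminilCopin2016];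
  R. B. Griffiths, C. A. Hurst, S. Sherman, J. Math. Phys. 11 (1970) [GriffithsHurstSherman1970];
  M. Aizenman, Comm. Math. Phys. 86 (1982) [Aizenman1982];
  M. Aizenman, H. Duminil-Copin, V. Sidoravicius, Comm. Math. Phys. 334 (2015), Lemma 2.2
  [AizenmanDuminilCopinSidoraviciusCMP2015].
-/

noncomputable section

open Finset Filter Topology
open scoped symmDiff ENNReal

namespace Literature.Probability.LatticeModels

variable {V : Type*} [Fintype V] {G : SimpleGraph V} [DecidableRel G.Adj]

namespace Current

/-! ### The weight identity and summability -/

section Weights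

variable [DecidableEq V]

omit [DecidableEq V] in
/-- **`w_K(n) w_K(m - n) = w_K(m) binom(m,n)`** for `n ≤ m` (Duminil-Copin 2016, proof of Lemma 2.2, edge by
edge `K^a/a! · K^{c-a}/(c-a)! = K^c/c! · C(c,a)`). [cite: DuminilCopin2016, proof of Lemma 2.2] -/
theorem wweight_mul_wweight_tsub (K : G.edgeFinset → ℝ) {m n : Current G} (h : n ≤ m) :
    n.wweight K * (m - n).wweight K = m.wweight K * (binom m n : ℝ) := by
  unfold wweight binom
  rw [Nat.cast_prod, ← prod_mul_distrib, ← prod_mul_distrib]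
  exact prod_congr rfl fun e _ => pow_div_factorial_mul (h e) (K e)

omit [DecidableEq V] in
/-- The same identity for the `ℝ≥0∞` weights (`K ≥ 0`). [cite: DuminilCopin2016, proof of Lemma 2.2] -/
theorem eweight_mul_eweight_tsub {K : G.edgeFinset → ℝ} (hK : ∀ e, 0 ≤ K e) {m n : Current G} (h : n ≤ m) :
    n.eweight K * (m - n).eweight K = m.eweight K * (binom m n : ℝ≥0∞) := by
  unfold eweight
  rw [← ENNReal.ofReal_mul (wweight_nonneg hK n), wweight_mul_wweight_tsub K h,
    ENNReal.ofReal_mul (wweight_nonneg hK m), ENNReal.ofReal_natCast]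

/-- `∑_{n : n_e < N} w_K(n) ∏_e b_e^{n_e} = ∏_e ∑_{k<N} (K_e b_e)^k/k!`. [cite: DuminilCopin2016, §2.1, eq. (2.2)] -/
theorem sum_piFinset_wweight_mul (K b : G.edgeFinset → ℝ) (N : ℕ) :
    ∑ n ∈ Fintype.piFinset (fun _ : G.edgeFinset => range N), wweight K n * ∏ e, b e ^ n e =
      ∏ e : G.edgeFinset, ∑ k ∈ range N, (K e * b e) ^ k / (k.factorial : ℝ) := by
  rw [Finset.prod_univ_sum]
  refine Finset.sum_congr rfl fun n _ => ?_
  rw [wweight, ← Finset.prod_mul_distrib]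
  exact Finset.prod_congr rfl fun e _ => by rw [mul_pow]; ring

/-- Bounded partial sums: `∑_{n ∈ S} w_K(n) ≤ ∏_e exp(K_e)` for `K ≥ 0`. [cite: DuminilCopin2016, §2.1] -/
theorem sum_wweight_le {K : G.edgeFinset → ℝ} (hK : ∀ e, 0 ≤ K e) (S : Finset (Current G)) :
    ∑ n ∈ S, n.wweight K ≤ ∏ e : G.edgeFinset, Real.exp (K e) := by
  set N := S.sup (fun n => univ.sup n) + 1 with hN
  have hS : S ⊆ Fintype.piFinset fun _ : G.edgeFinset => range N := by
    intro n hn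
    rw [Fintype.mem_piFinset]
    intro e
    rw [mem_range]
    have h1 : n e ≤ univ.sup n := Finset.le_sup (f := n) (mem_univ e)
    have h2 : univ.sup n ≤ S.sup (fun n => univ.sup n) := Finset.le_sup (f := fun n : Current G => univ.sup n) hn
    omega
  calc ∑ n ∈ S, n.wweight K
      ≤ ∑ n ∈ Fintype.piFinset (fun _ : G.edgeFinset => range N), wweight K n :=
        Finset.sum_le_sum_of_subset_of_nonneg hS fun n _ _ => wweight_nonneg hK n
    _ = ∏ e : G.edgeFinset, ∑ k ∈ range N, K e ^ k / (k.factorial : ℝ) := by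
        have h := sum_piFinset_wweight_mul K (fun _ => 1) N
        simp only [one_pow, Finset.prod_const_one, mul_one] at h
        exact h
    _ ≤ ∏ e : G.edgeFinset, Real.exp (K e) :=
        Finset.prod_le_prod (fun e _ => Finset.sum_nonneg fun k _ =>
            div_nonneg (pow_nonneg (hK e) _) (Nat.cast_nonneg _))
          fun e _ => Real.sum_le_exp_of_nonneg (hK e) N

omit [DecidableEq V] in
/-- **The weights `w_K` are summable over all currents** (`K ≥ 0`). [cite: DuminilCopin2016, §2.1] -/
theorem summable_wweight {K : G.edgeFinset → ℝ} (hK : ∀ e, 0 ≤ K e) : Summable fun n : Current G => n.wweight K := by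
  classical
  exact summable_of_sum_le (fun n => wweight_nonneg hK n) (sum_wweight_le hK)

omit [DecidableEq V] in
/-- Indicator-restricted weights are summable (`K ≥ 0`). [cite: DuminilCopin2016, §2.1] -/
theorem summable_wweight_indicator {K : G.edgeFinset → ℝ} (hK : ∀ e, 0 ≤ K e) (p : Current G → Prop)
    [DecidablePred p] : Summable fun n : Current G => if p n then n.wweight K else 0 := by
  refine (summable_wweight hK).of_nonneg_of_le (fun n => ?_) fun n => ?_
  · split_ifs
    · exact wweight_nonneg hK n
    · exact le_rfl
  · split_ifs
    · exact le_rfl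
    · exact wweight_nonneg hK n

omit [DecidableEq V] in
/-- `∑_n eweight K n < ∞`. [cite: DuminilCopin2016, §2.1] -/
theorem tsum_eweight_ne_top {K : G.edgeFinset → ℝ} (hK : ∀ e, 0 ≤ K e) : ∑' n : Current G, n.eweight K ≠ ∞ :=
  (summable_wweight hK).tsum_ofReal_ne_top

omit [DecidableEq V] in
/-- An indicator-restricted `ℝ≥0∞` current sum is finite. [folklore] -/
theorem tsum_ite_eweight_ne_top {K : G.edgeFinset → ℝ} (hK : ∀ e, 0 ≤ K e) (p : Current G → Prop)
    [DecidablePred p] : (∑' n : Current G, if p n then n.eweight K else 0) ≠ ∞ :=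
  ne_top_of_le_ne_top (tsum_eweight_ne_top hK) (ENNReal.tsum_le_tsum fun n => by
    split_ifs
    · exact le_rfl
    · exact bot_le)

end Weights

/-! ### Resummation over the total current -/

section Resum

variable [DecidableEq V]

/-- **Resummation over the total current** (`ℝ≥0∞`, unconditional):
`∑_{(n₁,n₂)} w(n₁) w(n₂) Ψ(n₁,n₂) = ∑_m w(m) ∑_{n ≤ m} binom(m,n) Ψ(n, m-n)` — reindex by the injection
`(n₁,n₂) ↦ (n₁, n₁+n₂)` and sum the finite fibres (Duminil-Copin 2016, proof of Lemma 2.2, first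
display; weighted `w_K`, `K ≥ 0`). [cite: DuminilCopin2016, proof of Lemma 2.2] -/
theorem tsum_prod_eweight_mul_eq {K : G.edgeFinset → ℝ} (hK : ∀ e, 0 ≤ K e)
    (Ψ : Current G → Current G → ℝ≥0∞) :
    ∑' p : Current G × Current G, p.1.eweight K * p.2.eweight K * Ψ p.1 p.2 =
      ∑' m : Current G, m.eweight K * ∑ n ∈ m.below, (binom m n : ℝ≥0∞) * Ψ n (m - n) := by
  classical
  set f : Current G × Current G → ℝ≥0∞ := fun p => p.1.eweight K * p.2.eweight K * Ψ p.1 p.2 with hf_def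
  set j : Current G × Current G → Current G × Current G := fun p => (p.1, p.1 + p.2) with hj_def
  have hj : Function.Injective j := by
    rintro ⟨a, b⟩ ⟨c, d⟩ h
    simp only [hj_def, Prod.mk.injEq] at h
    obtain ⟨rfl, h2⟩ := h
    exact Prod.ext rfl (add_left_cancel h2)
  set g : Current G × Current G → ℝ≥0∞ := fun q =>
    if q.1 ≤ q.2 then q.1.eweight K * (q.2 - q.1).eweight K * Ψ q.1 (q.2 - q.1) else 0 with hg_def
  have hgj : ∀ p, g (j p) = f p := by
    intro p
    simp only [hg_def, hj_def, hf_def]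
    rw [if_pos le_self_add, add_tsub_cancel_left]
  have hsupp : Function.support g ⊆ Set.range j := by
    intro q hq
    by_cases h : q.1 ≤ q.2
    · exact ⟨(q.1, q.2 - q.1), Prod.ext rfl (add_tsub_cancel_of_le h)⟩
    · exact absurd (if_neg h) hq
  have h1 : ∑' p, f p = ∑' q, g q := by
    rw [← hj.tsum_eq hsupp]
    exact tsum_congr fun p => (hgj p).symm
  have h2 : ∑' q, g q = ∑' m, ∑' n, g (n, m) := by
    rw [ENNReal.tsum_prod', ENNReal.tsum_comm]
  have h3 : ∀ m : Current G,
      ∑' n, g (n, m) = m.eweight K * ∑ n ∈ m.below, (binom m n : ℝ≥0∞) * Ψ n (m - n) := by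
    intro m
    rw [tsum_eq_sum (s := m.below) fun n hn => by
      rw [mem_below_iff] at hn; exact if_neg hn, Finset.mul_sum]
    refine Finset.sum_congr rfl fun n hn => ?_
    rw [mem_below_iff] at hn
    simp only [hg_def]
    rw [if_pos hn, eweight_mul_eweight_tsub hK hn]
    ring
  change ∑' p, f p = _
  rw [h1, h2]
  exact tsum_congr h3

end Resum

/-! ### The switching lemma -/

section Switching

variable [DecidableEq V] (G₁ : SimpleGraph V) [DecidableRel G₁.Adj]

/-- The `m`-resolved form of one side of the switching lemma, in `ℝ≥0∞` (the tree's
`Current.sum_below_binom_mul_eq` after `ENNReal.ofReal`): with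
`Ψ_{A,B}(n₁,n₂) = 𝟙[n₁ ⊆ E(G₁), ∂n₁ = A] 𝟙[∂n₂ ∩ Λ = B] H(n₁+n₂)`,
`∑_{n ≤ m} binom(m,n) Ψ_{A,B}(n, m-n) = H(m) 𝟙[(∂m Δ A) ∩ Λ = B] S_m(A)`. [cite: DuminilCopin2016, proof of Lemma 2.2] -/
theorem sum_below_binom_mul_eq_ennreal (m : Current G) (Λ A B : Finset V) (H : Current G → ℝ≥0∞) :
    ∑ n ∈ m.below, (binom m n : ℝ≥0∞) *
        ((if IsSupp G₁ n ∧ n.sources = A then (1 : ℝ≥0∞) else 0) *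
          (if (m - n).sources ∩ Λ = B then (1 : ℝ≥0∞) else 0) * H (n + (m - n))) =
      H m * (if (m.sources ∆ A) ∩ Λ = B then 1 else 0) * ENNReal.ofReal (switchCount G₁ m A) := by
  unfold switchCount
  rw [belowIn_eq_filter, Finset.sum_filter,
    ENNReal.ofReal_sum_of_nonneg (fun n _ => by split_ifs <;> positivity), Finset.mul_sum]
  refine Finset.sum_congr rfl fun n hn => ?_
  rw [mem_below_iff] at hn
  have hst : (m - n).sources = m.sources ∆ n.sources := by
    have hm : m.sources = ((m - n) + n).sources := by rw [tsub_add_cancel_of_le hn]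
    rw [hm, sources_add, symmDiff_assoc, symmDiff_self, symmDiff_bot]
  rw [add_tsub_cancel_of_le hn, hst]
  by_cases hsupp : IsSupp G₁ n
  · by_cases hsA : n.sources = A
    · rw [if_pos ⟨hsupp, hsA⟩, if_pos hsupp, if_pos hsA, hsA, ENNReal.ofReal_natCast]; ring
    · rw [if_neg (fun h => hsA h.2), if_pos hsupp, if_neg hsA, ENNReal.ofReal_zero]; ring
  · rw [if_neg (fun h => hsupp h.1), if_neg hsupp, ENNReal.ofReal_zero]; ring

/-- **The switching lemma for edge-dependent couplings** (Panis 2023, Lemma 4.4 (SL);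
Griffiths–Hurst–Sherman 1970; Aizenman 1982; nested form of ADS 2015, Lemma 2.2, as the tree's
`Current.tsum_switching`), in `ℝ≥0∞` and for `K ≥ 0`: for a subgraph `G₁`, a volume `Λ`, vertices `x, y`,
finite sets `A, B` and every `F : Ω → ℝ≥0∞`,
`∑_{(n₁,n₂)} 𝟙[n₁ ⊆ E(G₁), ∂n₁ = A] 𝟙[∂n₂ ∩ Λ = B] w_K(n₁) w_K(n₂) F(n₁+n₂) 𝟙[x ↔ y in E(G₁)]`
`= ∑_{(n₁,n₂)} 𝟙[n₁ ⊆ E(G₁), ∂n₁ = A Δ {x} Δ {y}] 𝟙[∂n₂ ∩ Λ = B Δ (({x} Δ {y}) ∩ Λ)] w_K(n₁) w_K(n₂) F(n₁+n₂) 𝟙[x ↔ y in E(G₁)]`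
(`x ↔ y in E(G₁)` = `Current.connIn G₁ x y` of `n₁ + n₂`). Proof: resummation over `m = n₁ + n₂`
(`tsum_prod_eweight_mul_eq`) and the weight-free count identity `Current.switchCount_symmDiff`.
[cite: Panis2023Triviality, Lemma 4.4] -/
theorem etsum_switching {K : G.edgeFinset → ℝ} (hK : ∀ e, 0 ≤ K e) (Λ A B : Finset V) (x y : V)
    (F : Current G → ℝ≥0∞) :
    ∑' p : Current G × Current G,
        (if IsSupp G₁ p.1 ∧ p.1.sources = A then p.1.eweight K else 0) *
          (if p.2.sources ∩ Λ = B then p.2.eweight K else 0) *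
          (F (p.1 + p.2) * (connIn G₁ x y).indicator 1 (p.1 + p.2)) =
      ∑' p : Current G × Current G,
        (if IsSupp G₁ p.1 ∧ p.1.sources = A ∆ ({x} ∆ {y}) then p.1.eweight K else 0) *
          (if p.2.sources ∩ Λ = B ∆ (({x} ∆ {y}) ∩ Λ) then p.2.eweight K else 0) *
          (F (p.1 + p.2) * (connIn G₁ x y).indicator 1 (p.1 + p.2)) := by
  classical
  set H : Current G → ℝ≥0∞ := fun m => F m * (connIn G₁ x y).indicator 1 m with hH_def
  set Ψ : Finset V → Finset V → Current G → Current G → ℝ≥0∞ := fun A' B' n₁ n₂ =>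
    (if IsSupp G₁ n₁ ∧ n₁.sources = A' then (1 : ℝ≥0∞) else 0) *
      (if n₂.sources ∩ Λ = B' then (1 : ℝ≥0∞) else 0) * H (n₁ + n₂) with hΨ_def
  have hre : ∀ A' B', ∑' p : Current G × Current G,
      (if IsSupp G₁ p.1 ∧ p.1.sources = A' then p.1.eweight K else 0) *
        (if p.2.sources ∩ Λ = B' then p.2.eweight K else 0) * H (p.1 + p.2) =
      ∑' m : Current G, m.eweight K *
        (H m * (if (m.sources ∆ A') ∩ Λ = B' then 1 else 0) * ENNReal.ofReal (switchCount G₁ m A')) := by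
    intro A' B'
    have h1 : ∀ p : Current G × Current G,
        (if IsSupp G₁ p.1 ∧ p.1.sources = A' then p.1.eweight K else 0) *
          (if p.2.sources ∩ Λ = B' then p.2.eweight K else 0) * H (p.1 + p.2) =
        p.1.eweight K * p.2.eweight K * Ψ A' B' p.1 p.2 := by
      intro p; simp only [hΨ_def]; split_ifs <;> ring
    simp_rw [h1]
    rw [tsum_prod_eweight_mul_eq hK (Ψ A' B')]
    refine tsum_congr fun m => ?_
    rw [sum_below_binom_mul_eq_ennreal G₁ m Λ A' B' H]
  change ∑' p : Current G × Current G,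
      (if IsSupp G₁ p.1 ∧ p.1.sources = A then p.1.eweight K else 0) *
        (if p.2.sources ∩ Λ = B then p.2.eweight K else 0) * H (p.1 + p.2) =
    ∑' p : Current G × Current G,
      (if IsSupp G₁ p.1 ∧ p.1.sources = A ∆ ({x} ∆ {y}) then p.1.eweight K else 0) *
        (if p.2.sources ∩ Λ = B ∆ (({x} ∆ {y}) ∩ Λ) then p.2.eweight K else 0) * H (p.1 + p.2)
  rw [hre, hre]
  refine tsum_congr fun m => ?_
  have hite : (if (m.sources ∆ (A ∆ ({x} ∆ {y}))) ∩ Λ = B ∆ (({x} ∆ {y}) ∩ Λ) then (1 : ℝ≥0∞) else 0) =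
      if (m.sources ∆ A) ∩ Λ = B then 1 else 0 := by
    by_cases hB : (m.sources ∆ A) ∩ Λ = B
    · rw [if_pos hB, if_pos ((symmDiff_inter_eq_iff _ _ _ _ _).2 hB)]
    · rw [if_neg hB, if_neg fun h => hB ((symmDiff_inter_eq_iff _ _ _ _ _).1 h)]
  rw [hite]
  by_cases hconn : (Percolation.openGraph (m.tracedIn G₁)).Reachable x y
  · rw [← switchCount_symmDiff G₁ hconn A]
  · have hH0 : H m = 0 := by
      simp only [hH_def, Set.indicator_apply, Set.mem_setOf_eq, connIn, if_neg hconn, mul_zero]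
    rw [hH0]; ring

/-- **The switching lemma, classical form** (`Λ = univ`, both sources prescribed exactly, no support
restriction on the second current; Panis 2023, Lemma 4.4 with `B` a pair): for `K ≥ 0` and `F : Ω → ℝ≥0∞`,
`∑ 𝟙[n₁ ⊆ E(G₁), ∂n₁ = A] 𝟙[∂n₂ = B] w w F(n₁+n₂) 𝟙[x ↔ y in E(G₁)]
 = ∑ 𝟙[n₁ ⊆ E(G₁), ∂n₁ = A Δ {x} Δ {y}] 𝟙[∂n₂ = B Δ {x} Δ {y}] w w F(n₁+n₂) 𝟙[x ↔ y in E(G₁)]`.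
[cite: Panis2023Triviality, Lemma 4.4] -/
theorem etsum_switching_univ {K : G.edgeFinset → ℝ} (hK : ∀ e, 0 ≤ K e) (A B : Finset V) (x y : V)
    (F : Current G → ℝ≥0∞) :
    ∑' p : Current G × Current G,
        (if IsSupp G₁ p.1 ∧ p.1.sources = A then p.1.eweight K else 0) *
          (if p.2.sources = B then p.2.eweight K else 0) *
          (F (p.1 + p.2) * (connIn G₁ x y).indicator 1 (p.1 + p.2)) =
      ∑' p : Current G × Current G,
        (if IsSupp G₁ p.1 ∧ p.1.sources = A ∆ ({x} ∆ {y}) then p.1.eweight K else 0) *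
          (if p.2.sources = B ∆ ({x} ∆ {y}) then p.2.eweight K else 0) *
          (F (p.1 + p.2) * (connIn G₁ x y).indicator 1 (p.1 + p.2)) := by
  have h := etsum_switching G₁ hK univ A B x y F
  simp only [Finset.inter_univ] at h
  exact h

end Switching

end Current

end Literature.Probability.LatticeModels

end
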